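import Mathlib
import HarnessLib
import Summits.QuantumFields.YangMills.Theorems.MirrorModularBoostsHypercubicLimitCouplingResponseDefsC

/-!
# Expansion of the `n`-fold Wilson moment over plane/site assignments (stub `stub_expansion`)

Stub `stub_expansion` of line `Sketch` for crux `SelfNormalisedMomentBoundsR` (item `stmt-QuantumFields-18014`,
route `ScalingWindowSplit` of `QuantumFields/YangMills`) — piece A1 of the discrete phase-cell assembly.  Pure proof
file.

Every smeared plane field is a finite sum over the lattice points of the box,
`Φ^P_k(f)(U) = Σ_{(q,x)} c a⁴ f^q(a x) Ψ_{(q,x)}(U)` with `Ψ_{(q,x)}(U) = O_q(τ_x Ũ) − m/6`; hence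

* `prod_fieldP_eq` — `∏ᵢ Φ^P_k(Fᵢ)(U) = Σ_g (∏ᵢ a⁴ Fᵢ^{qᵢ}(a xᵢ)) · cⁿ ∏ᵢ Ψ_{g i}(U)` over all assignments
  `g : i ↦ (qᵢ, xᵢ)` (`Finset.prod_univ_sum`);
* `integral_prod_fieldP_eq` — the same identity integrated termwise against Wilson's torus measure (each `∏ᵢ Ψ_{g i}`
  is bounded and measurable, `integrable_prod_centred`);
* `prod_weight_eq_zero` — an assignment with a repeated site has weight `∏ᵢ a⁴ |Fᵢ^{qᵢ}(a xᵢ)| = 0` when the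
  6-tuples are pairwise plane-wise disjointly supported (two non-zero values at one point would put it in two disjoint
  supports);
* `stub_expansion` — `|Σ| ≤ Σ |·|`, and only injective site families survive.
-/

noncomputable section

open scoped SchwartzMap BigOperators Topology
open MeasureTheory Filter Topology
open Literature.MathematicalPhysics.AQFT Literature.MathematicalPhysics.QuantumLattice
open Literature.MathematicalPhysics.QuantumFieldTheory Literature.Probability.LatticeModels
open Summit.QuantumFields.YangMills.Cruxes.HypercubicLimit.CouplingResponse

namespace Summit.QuantumFields.YangMills.Theorems.ScalingWindowSplit.SelfNormalisedMomentBoundsR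

namespace StubExpansion

variable {G : Type} [Group G] [TopologicalSpace G] [IsTopologicalGroup G] [CompactSpace G]
  [MeasurableSpace G] [BorelSpace G]

/-- **A plane field as ONE finite sum** over pairs (plane, box site):
`Φ^P_k(f)(U) = Σ_{(q,x)} a⁴ f^q(a x) · c (O_q(τ_x Ũ) − m/6)`. [folklore] -/
theorem fieldP_eq_sum (r : LatticeRep G) (S : SpeciesScheme (YMSpecies G)) (k : ℕ)
    (f : Plane → 𝓢(EuclideanSpace ℝ (Fin 4), ℝ)) (U : GaugeConfig 4 (S.side k) G) :
    fieldP r S k f U = ∑ p ∈ (Finset.univ : Finset Plane) ×ˢ box 4 (S.L k),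
      S.a k ^ 4 * f p.1 (S.a k • siteToE p.2) *
        (S.c r.curvature k * ((planeSpecies r p.1).F (configShift (-p.2) (torusLift (S.side k) U)) -
          S.m r.curvature k / 6)) := by
  rw [Finset.sum_product]
  unfold fieldP planeField smearedLatticeField
  refine Finset.sum_congr rfl fun q _ => ?_
  rw [Finset.mul_sum]
  refine Finset.sum_congr rfl fun x _ => ?_
  ring

/-- **Pointwise expansion of the product** over assignments `g : i ↦ (qᵢ, xᵢ)`:
`∏ᵢ Φ^P_k(Fᵢ)(U) = Σ_g (∏ᵢ a⁴ Fᵢ^{qᵢ}(a xᵢ)) · (cⁿ ∏ᵢ (O_{qᵢ}(τ_{xᵢ} Ũ) − m/6))`. [folklore] -/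
theorem prod_fieldP_eq (r : LatticeRep G) (S : SpeciesScheme (YMSpecies G)) (k : ℕ) {n : ℕ}
    (F : Fin n → Plane → 𝓢(EuclideanSpace ℝ (Fin 4), ℝ)) (U : GaugeConfig 4 (S.side k) G) :
    ∏ i, fieldP r S k (F i) U =
      ∑ g ∈ Fintype.piFinset (fun _ : Fin n => (Finset.univ : Finset Plane) ×ˢ box 4 (S.L k)),
        (∏ i, S.a k ^ 4 * F i (g i).1 (S.a k • siteToE (g i).2)) *
          (S.c r.curvature k ^ n *
            ∏ i, ((planeSpecies r (g i).1).F (configShift (-(g i).2) (torusLift (S.side k) U)) -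
              S.m r.curvature k / 6)) := by
  simp_rw [fieldP_eq_sum]
  rw [Finset.prod_univ_sum]
  refine Finset.sum_congr rfl fun g _ => ?_
  rw [Finset.prod_mul_distrib]
  congr 1
  rw [Finset.prod_mul_distrib, Fin.prod_const]

/-- Each product `∏ᵢ (O_{qᵢ}(τ_{xᵢ} Ũ) − m/6)` of centred shifted plaquette observables is integrable for Wilson's
torus measure (bounded and measurable on a probability space). [folklore] -/
theorem integrable_prod_centred (r : LatticeRep G) (S : SpeciesScheme (YMSpecies G)) (k : ℕ) {n : ℕ}
    (g : Fin n → Plane × Site 4) :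
    Integrable (fun U : GaugeConfig 4 (S.side k) G =>
      ∏ i, ((planeSpecies r (g i).1).F (configShift (-(g i).2) (torusLift (S.side k) U)) -
        S.m r.curvature k / 6)) (wilsonAt r S k) := by
  haveI : IsProbabilityMeasure (wilsonAt r S k) :=
    isProbabilityMeasure_wilsonMeasure (d := 4) (L := S.side k) r.ρ r.continuous (S.β k)
  choose C hC using fun q : Plane => (planeSpecies r q).bounded
  have hmeas : ∀ i, Measurable fun U : GaugeConfig 4 (S.side k) G =>
      (planeSpecies r (g i).1).F (configShift (-(g i).2) (torusLift (S.side k) U)) - S.m r.curvature k / 6 :=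
    fun i => ((planeSpecies r (g i).1).measurable.comp
      ((Literature.MathematicalPhysics.QuantumLattice.configShift (-(g i).2)).measurable.comp
        (measurable_torusLift (S.side k)))).sub measurable_const
  refine Integrable.of_bound (Finset.measurable_prod _ fun i _ => hmeas i).aestronglyMeasurable
    (∏ i, (C (g i).1 + |S.m r.curvature k / 6|)) (ae_of_all _ fun U => ?_)
  rw [Real.norm_eq_abs, Finset.abs_prod]
  exact Finset.prod_le_prod (fun i _ => abs_nonneg _) fun i _ =>
    (abs_sub _ _).trans (add_le_add (hC _ _) le_rfl)

/-- **The `n`-fold Wilson moment expanded over assignments**: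
`∫ ∏ᵢ Φ^P_k(Fᵢ) dμ_k = Σ_g (∏ᵢ a⁴ Fᵢ^{qᵢ}(a xᵢ)) · cⁿ ∫ ∏ᵢ (O_{qᵢ}(τ_{xᵢ} Ũ) − m/6) dμ_k`. [folklore] -/
theorem integral_prod_fieldP_eq (r : LatticeRep G) (S : SpeciesScheme (YMSpecies G)) (k : ℕ) {n : ℕ}
    (F : Fin n → Plane → 𝓢(EuclideanSpace ℝ (Fin 4), ℝ)) :
    ∫ U, ∏ i, fieldP r S k (F i) U ∂(wilsonAt r S k) =
      ∑ g ∈ Fintype.piFinset (fun _ : Fin n => (Finset.univ : Finset Plane) ×ˢ box 4 (S.L k)),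
        (∏ i, S.a k ^ 4 * F i (g i).1 (S.a k • siteToE (g i).2)) *
          (S.c r.curvature k ^ n *
            ∫ U, ∏ i, ((planeSpecies r (g i).1).F (configShift (-(g i).2) (torusLift (S.side k) U)) -
              S.m r.curvature k / 6) ∂(wilsonAt r S k)) := by
  simp_rw [prod_fieldP_eq]
  rw [integral_finsetSum _ fun g _ => ((integrable_prod_centred r S k g).const_mul _).const_mul _]
  refine Finset.sum_congr rfl fun g _ => ?_
  rw [integral_const_mul, integral_const_mul]

/-- **Repeated sites carry weight zero.** If the 6-tuples `Fᵢ` are pairwise plane-wise disjointly supported and the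
site family of the assignment `g` is not injective, then `∏ᵢ a⁴ |Fᵢ^{qᵢ}(a xᵢ)| = 0`: at the repeated site two
non-zero values would put the point `a x` in two disjoint supports. [folklore] -/
theorem prod_weight_eq_zero {n : ℕ} (F : Fin n → Plane → 𝓢(EuclideanSpace ℝ (Fin 4), ℝ))
    (hD : ∀ i j, i ≠ j → DisjP (F i) (F j)) (a : ℝ) {g : Fin n → Plane × Site 4}
    (hg : ¬ Function.Injective (fun i => (g i).2)) :
    ∏ i, a ^ 4 * |F i (g i).1 (a • siteToE (g i).2)| = 0 := by
  obtain ⟨i, j, hij, hne⟩ := Function.not_injective_iff.1 hg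
  have hij' : (g i).2 = (g j).2 := hij
  by_cases hi : F i (g i).1 (a • siteToE (g i).2) = 0
  · exact Finset.prod_eq_zero (Finset.mem_univ i) (by rw [hi, abs_zero, mul_zero])
  by_cases hj : F j (g j).1 (a • siteToE (g j).2) = 0
  · exact Finset.prod_eq_zero (Finset.mem_univ j) (by rw [hj, abs_zero, mul_zero])
  exfalso
  have h1 : a • siteToE (g i).2 ∈ tsupport (F i (g i).1) := subset_tsupport _ (Function.mem_support.2 hi)
  have h2 : a • siteToE (g i).2 ∈ tsupport (F j (g j).1) := by
    rw [hij']
    exact subset_tsupport _ (Function.mem_support.2 hj)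
  exact Set.disjoint_left.1 (hD i j hne (g i).1 (g j).1) h1 h2

end StubExpansion

open StubExpansion in
/-- **Registered stub `stub_expansion` (line `Sketch`; piece A1 of the assembly).**  Expanding every smeared plane
field over the lattice points of the box, the `n`-fold Wilson moment is bounded by the sum, over all assignments
`g : i ↦ (qᵢ, xᵢ)` of a plane and a box site to each index, of the weight `∏ᵢ a⁴ |Fᵢ^{qᵢ}(a xᵢ)|` times the
normalised centred plaquette correlation `|cⁿ ∫ ∏ᵢ (O_{qᵢ}(τ_{xᵢ}Ũ) − m/6) dμ|` — and assignments with a repeated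
site carry weight zero (pairwise plane-wise disjoint supports), so only INJECTIVE site families count. [folklore] -/
theorem stub_expansion :
    ∀ (G : Type) [Group G] [TopologicalSpace G] [IsTopologicalGroup G] [CompactSpace G] [MeasurableSpace G]
      [BorelSpace G] (r : LatticeRep G) (S : SpeciesScheme (YMSpecies G)) (k n : ℕ)
      (F : Fin n → Plane → 𝓢(EuclideanSpace ℝ (Fin 4), ℝ)),
      (∀ i j, i ≠ j → DisjP (F i) (F j)) →
      |∫ U, ∏ i, fieldP r S k (F i) U ∂(wilsonAt r S k)| ≤
        ∑ g ∈ Fintype.piFinset (fun _ : Fin n => (Finset.univ : Finset Plane) ×ˢ box 4 (S.L k)),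
          (∏ i, S.a k ^ 4 * |F i (g i).1 (S.a k • siteToE (g i).2)|) *
            (if Function.Injective (fun i => (g i).2) then
              |S.c r.curvature k ^ n *
                ∫ U, ∏ i, ((planeSpecies r (g i).1).F (configShift (-(g i).2) (torusLift (S.side k) U)) -
                  S.m r.curvature k / 6) ∂(wilsonAt r S k)|
            else 0) := by
  intro G _ _ _ _ _ _ r S k n F hD
  rw [integral_prod_fieldP_eq]
  refine (Finset.abs_sum_le_sum_abs _ _).trans (Finset.sum_le_sum fun g _ => ?_)
  have habs : |∏ i, S.a k ^ 4 * F i (g i).1 (S.a k • siteToE (g i).2)| =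
      ∏ i, S.a k ^ 4 * |F i (g i).1 (S.a k • siteToE (g i).2)| := by
    rw [Finset.abs_prod]
    exact Finset.prod_congr rfl fun i _ => by rw [abs_mul, abs_of_nonneg (pow_nonneg (S.a_pos k).le 4)]
  rw [abs_mul, habs]
  split_ifs with hg
  · exact le_rfl
  · rw [prod_weight_eq_zero F hD (S.a k) hg, zero_mul, zero_mul]

end Summit.QuantumFields.YangMills.Theorems.ScalingWindowSplit.SelfNormalisedMomentBoundsR

end
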